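import Summits.QuantumFields.BalabanUV.T4Continuum.Support.NE7ApexHotHaarLaw
import Literature.MathematicalPhysics.QuantumFieldTheory.Balaban1983to89.T4ApexVariance

/-!
# NE7ApexHotScheme — row NE7 (node U5), the OWNER's calibration duty, family 2 («hot»): at β ≡ 0 a scheme whose observables are the
# traces of finitely many private-headed closed loops has ALL joint expectations and ALL dressed partition functions CONSTANT IN THE
# CUTOFF — hence `Missing.HasContinuumLimit S` and `T4ApexVariance.StringwiseMatching S` with remainder `δ_K = 0`

Lineage `b2b-balaban-t4-ne7-p1` (CRUX PROVER NE7 #1 = OWNER of BINDER row NE7), generation 37; SCHEME level, definition-free (the concrete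
instance — lattice lines through the origin on the `d = 4` tori `params4`, any compact gauge datum incl. `SU(N)` — is `NE7ApexHotWitness`).
Tags **[folklore]** ∕ **[our toy]**; nothing printed is asserted and nothing internally minted is cited (ABSOLUTE RULE); used BY NAME:
`Missing` (`TorusScheme`, `expectAt`, `expect`, `partitionFn`, `boltzmann`, `HasContinuumLimit`), `T4GenFunBounds` (`prodObs`, `schemeZ`,
`dressedZ`), `T4CauchySum.MatchingModConstants`, `T4ApexVariance.StringwiseMatching`, `T4Assembly.hasUniqueLimitPoints_of_hasContinuumLimit`,
`UnitaryModel.RegularGaugeGroup`, and gen 37's joint Haar law `NE7ApexHotHaarLaw.integral_comp_loopHols`.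

## Setting (section variables)

A scheme `S : Missing.TorusScheme G O` over ANY `[GaugeGroup G] [MeasurableSpace G] [HaarData G] [RegularGaugeGroup G]` with `hβ : ∀ K, S.β K = 0`
(infinite temperature: the Wilson weight is `1`, the lattice measure IS the product Haar measure), a FINITE type `ι` of loop classes with a class
map `cls : O → ι`, at every cutoff `K` a private-headed family of closed loops `(σ K i, b K i)_{i : ι}` of the `K`-th lattice (`hL`, `hP` as in
`NE7ApexHotHaarLaw`), and observables `hobs : S.obs K o U = reTr (loopHol (σ K (cls o)) (b K (cls o)) U)` (labels of one class read the
same loop; the loops, their lengths and positions may vary with `K` at will).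

## What is proved

* §1 `β = 0` bookkeeping: `boltzmann_zero`, `partitionFn_zero` (`Z = 1`), `expect_zero` (`⟨F⟩ = ∫ F dU`), `dressedZ_zero` (`Z(t) = ∫ e^{tF} dU`);
  `measurable_listProd_reTr` (the class-level product observable is measurable).
* §2 **`expectAt_eq`**: `S.expectAt K os = ∫ (∏_{o ∈ os} reTr (g (cls o))) dHaar^ι(g)` — the right side does not mention `K`;
  **`hasContinuumLimit`**, `hasUniqueLimitPoints`; **`schemeZ_eq`**: `schemeZ S os K t = ∫ exp(t·∏_{o ∈ os} reTr (g (cls o))) dHaar^ι(g)`;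
  **`matchingModConstants`** (`c_K = 0`, `δ_K = 0`, any radius, volume factor `0`); **`stringwiseMatching`**; **`apex`** (both predicates).

HONEST FRAMING: [our toy] — a DEGENERATE regime (β = 0: ultralocal, no dynamics, nothing flows; expectations are cutoff-independent constants,
e.g. `⟨W⟩ = ∫ reTr dHaar`, which is `0` on `SU(2)` — not `1` as in the frozen family `NE7ApexFrozen*`); a second NON-VACUITY ∕ CALIBRATION
family for node U5∕U0's apex PREDICATES on a `Missing.TorusScheme` of its own: NOT a `FiniteEpsData`, NOT asymptotic freedom, NOT Bałaban's
renormalisation scheme or averaged observables, NOT NE7; continuous non-abelian gauge groups allowed.  Route 1 (R-P1∘U2) UNCHANGED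
(KERNEL-COMPLETE AT FORM LEVEL ∕ DEPENDENT); spine PROVED 0∕9; FIXED FINITE T⁴, rung (B)+1 — NOT infinite volume, NOT mass gap, NOT
BetaPertH, NOT Clay.  HONEST DEPENDENCY: continuum YM on T⁴ ⇐ BetaPertH ∧ nine spine estimates (0/9 proved); BetaPertH ⇐ (D1) ∧ (D4) ∧
CAP+tail; G-an2-4 gates asym, D1 and NE2/3/4.
-/

set_option autoImplicit false

noncomputable section

open MeasureTheory Filter Topology
open scoped ENNReal

namespace Summit.QuantumFields.BalabanUV.T4Continuum.NE7ApexHotScheme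

open Literature.MathematicalPhysics.QuantumFieldTheory.Balaban1983to89
open Missing (boltzmann partitionFn expect TorusScheme HasContinuumLimit HasUniqueLimitPoints)
open T4TreeGaugeFixing (ClosedLoopIn)
open T4TreeGaugeTransform (loopHol measurable_loopHol)
open NE7ApexHotHaarLaw (integral_comp_loopHols measurable_loopHols)

/-! ## §1 `β = 0` bookkeeping -/

section Zero

variable {G : Type*} [GaugeGroup G] [MeasurableSpace G] [HaarData G]

omit [MeasurableSpace G] [HaarData G] in
/-- At `β = 0` the Wilson weight is `1`. [folklore] -/
theorem boltzmann_zero (P : Params) (U : GaugeField P 0 G) : boltzmann P 0 U = 1 := by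
  simp [boltzmann]

/-- At `β = 0` the partition function is `1` (the product Haar measure is a probability measure). [folklore] -/
theorem partitionFn_zero (P : Params) : partitionFn (G := G) P 0 = 1 := by
  simp [partitionFn, boltzmann_zero]

/-- At `β = 0` the expectation is the product-Haar integral: `⟨F⟩_{P,0} = ∫ F dU`. [folklore] -/
theorem expect_zero (P : Params) (F : GaugeField P 0 G → ℝ) : expect P 0 F = ∫ U, F U ∂fieldMeasure P 0 G := by
  simp [expect, boltzmann_zero, partitionFn_zero]

/-- At `β = 0` the dressed partition function is `Z(t) = ∫ e^{tF} dU`. [folklore] -/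
theorem dressedZ_zero (P : Params) (F : GaugeField P 0 G → ℝ) (t : ℝ) :
    T4GenFunBounds.dressedZ P 0 F t = ∫ U, Real.exp (t * F U) ∂fieldMeasure P 0 G := by
  simp [T4GenFunBounds.dressedZ, boltzmann_zero]

variable [RegularGaugeGroup G] {O ι : Type*} (cls : O → ι)

omit [HaarData G] in
/-- The class-level product observable `g ↦ ∏_{o ∈ os} reTr (g (cls o))` on `ι → G` is measurable. [folklore] -/
theorem measurable_listProd_reTr (os : List O) : Measurable fun g : ι → G => (os.map fun o => reTr (g (cls o))).prod := by
  induction os with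
  | nil => simp only [List.map_nil, List.prod_nil]; exact measurable_const
  | cons o os ih =>
    simp only [List.map_cons, List.prod_cons]
    exact (RegularGaugeGroup.measurable_reTr.comp (measurable_pi_apply (cls o))).mul ih

end Zero

/-! ## §2 The hot scheme: everything is constant in the cutoff -/

section Scheme

variable {G : Type*} [GaugeGroup G] [MeasurableSpace G] [HaarData G] [RegularGaugeGroup G] {O : Type*}
variable (S : TorusScheme G O) (hβ : ∀ K, S.β K = 0)
variable {ι : Type*} [Fintype ι] (cls : O → ι) {kk : ℕ → ι → ℕ}
  {σ : (K : ℕ) → (i : ι) → Fin (kk K i + 1) → Site (S.P K) 0}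
  {b : (K : ℕ) → (i : ι) → Fin (kk K i + 1) → PBond (S.P K) 0}
  (hL : ∀ K i, ClosedLoopIn Finset.univ (kk K i) (σ K i) (b K i))
  (hP : ∀ K i i', i ≠ i' → ∀ m, b K i' m ≠ b K i 0)
  (hobs : ∀ K o U, S.obs K o U = reTr (loopHol (σ K (cls o)) (b K (cls o)) U))
include hβ hL hP hobs

omit [MeasurableSpace G] [HaarData G] [RegularGaugeGroup G] [Fintype ι] hβ hL hP in
/-- The product observable of a string factors through the class holonomies:
`F_K(U) = ∏_{o ∈ os} reTr (hol_{cls o}(U))`. [folklore] -/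
theorem prodObs_eq (K : ℕ) (os : List O) (U : GaugeField (S.P K) 0 G) :
    T4GenFunBounds.prodObs S K os U =
      (fun g : ι → G => (os.map fun o => reTr (g (cls o))).prod) (fun i => loopHol (σ K i) (b K i) U) := by
  simp only [T4GenFunBounds.prodObs, hobs]

/-- **EVERY JOINT EXPECTATION IS CONSTANT IN THE CUTOFF**: `⟨∏_{o ∈ os} obs_K(o)⟩_K = ∫ ∏_{o ∈ os} reTr (g (cls o)) dHaar^ι(g)`. [folklore] -/
theorem expectAt_eq (K : ℕ) (os : List O) :
    S.expectAt K os = ∫ g, (os.map fun o => reTr (g (cls o))).prod ∂Measure.pi (fun _ : ι => (HaarData.haar : Measure G)) := by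
  classical
  have h1 : S.expectAt K os = expect (S.P K) (S.β K) (T4GenFunBounds.prodObs S K os) := rfl
  rw [h1, hβ K, expect_zero]
  simp_rw [prodObs_eq S cls hobs K os]
  exact integral_comp_loopHols (hL K) (hP K) (measurable_listProd_reTr cls os)

/-- **NODE U0 — `Missing.HasContinuumLimit S`** (every joint expectation is a constant sequence). [folklore] -/
theorem hasContinuumLimit : HasContinuumLimit S := fun os =>
  ⟨∫ g, (os.map fun o => reTr (g (cls o))).prod ∂Measure.pi (fun _ : ι => (HaarData.haar : Measure G)), by
    simp_rw [expectAt_eq S hβ cls hL hP hobs]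
    exact tendsto_const_nhds⟩

/-- Hence unique limit points (`T4Assembly.hasUniqueLimitPoints_of_hasContinuumLimit`). [folklore] -/
theorem hasUniqueLimitPoints : HasUniqueLimitPoints S :=
  T4Assembly.hasUniqueLimitPoints_of_hasContinuumLimit S (hasContinuumLimit S hβ cls hL hP hobs)

/-- **EVERY DRESSED PARTITION FUNCTION IS CONSTANT IN THE CUTOFF**:
`schemeZ S os K t = ∫ exp(t·∏_{o ∈ os} reTr (g (cls o))) dHaar^ι(g)`. [folklore] -/
theorem schemeZ_eq (os : List O) (K : ℕ) (t : ℝ) :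
    T4GenFunBounds.schemeZ S os K t =
      ∫ g, Real.exp (t * (os.map fun o => reTr (g (cls o))).prod) ∂Measure.pi (fun _ : ι => (HaarData.haar : Measure G)) := by
  classical
  have h1 : T4GenFunBounds.schemeZ S os K t = T4GenFunBounds.dressedZ (S.P K) (S.β K) (T4GenFunBounds.prodObs S K os) t := rfl
  rw [h1, hβ K, dressedZ_zero]
  simp_rw [prodObs_eq S cls hobs K os]
  exact integral_comp_loopHols (hL K) (hP K) (f := fun g : ι → G => Real.exp (t * (os.map fun o => reTr (g (cls o))).prod))
    (Real.measurable_exp.comp ((measurable_listProd_reTr cls os).const_mul t))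

/-- **NODE U5's SHAPE WITH ZERO REMAINDER**: matching modulo constants with `c_K = 0`, `δ_K = 0`, at every radius and volume factor.
[folklore] -/
theorem matchingModConstants (os : List O) (vol l₀ : ℝ) :
    T4CauchySum.MatchingModConstants vol l₀ (fun _ => 0) (T4GenFunBounds.schemeZ S os) := by
  intro K
  refine ⟨0, fun t _ => ?_⟩
  rw [schemeZ_eq S hβ cls hL hP hobs os (K + 1) t, schemeZ_eq S hβ cls hL hP hobs os K t]
  simp

/-- **NODE U5 — `T4ApexVariance.StringwiseMatching S`** (radius `1`, volume factor `0`, remainder `δ ≡ 0`). [folklore] -/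
theorem stringwiseMatching : T4ApexVariance.StringwiseMatching S := fun os =>
  ⟨1, 0, fun _ => 0, one_pos, summable_zero, matchingModConstants S hβ cls hL hP hobs os 0 1⟩

/-- **Both apex predicates at once** for the hot scheme. [folklore] -/
theorem apex : HasContinuumLimit S ∧ T4ApexVariance.StringwiseMatching S :=
  ⟨hasContinuumLimit S hβ cls hL hP hobs, stringwiseMatching S hβ cls hL hP hobs⟩

end Scheme

end Summit.QuantumFields.BalabanUV.T4Continuum.NE7ApexHotScheme

end
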